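import Summits.QuantumFields.YangMills.Theorems.BalabanUVNodesN08KFoldTransportEnvelopeT3

/-!
# BalabanUVNodes ∕ N08 — THE EXACT PATTERN PARTITION OF A GUARDED PUSH-FORWARD: `F_* μ = Σ_{s} (f_s)_*(μ↾{pat = s})` when `F = f_{pat}` on a finite pattern type — the
# identity (R1) of the (β4) design (firing patterns `Γ`, fixed hybrid composites `Φ_Γ`), stated once in generic form

Track A, DAG node N08 ([Balaban1985UV3] Thm 1 p. 257 ∕ Thm 2 p. 272; averaging [Balaban1987RG1] (0.4) p. 253).  Cell `pub-ymgap`, seat `pub-ymgap-dag-n08-d` g47 (R529-ym summon;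
DESIGN memo `N08-HJ-LOOPPART-DESIGN-g47.md` (M2)); `--supports stmt-QuantumFields-19936` (helper).  Companion of ✓p754015 §4 (`map_le_map_add_sum_map_restrict`, the one-step UPPER
bound that forgets the non-firing constraints — fine-lattice extensive if summed naively); THIS is the EXACT identity that keeps «exactly this pattern fires», which the polymer
expansion must use (DESIGN §2: never replace `{Γ(U) = Γ}` by `{Γ(U) ⊇ Γ}`).

CONTENTS ([folklore] measure theory; 0 `def`, 0 `sorry`): `measure_eq_sum_measure_inter_preimage_singleton` (finite pattern partition of a measure), ★★ `map_eq_sum_map_restrict_of_pattern`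
(`F x = f (pat x) x` ⇒ `μ.map F = Σ_s (μ.restrict (pat ⁻¹' {s})).map (f s)`), `map_le_sum_map_restrict_of_pattern_subset` (dropping to the patterns in a set `A ∋ pat x` a.e.-surely is `≤`).
At a guarded averaging: `pat U := {c | Small ℰ U c}` (a `Finset` of coarse bonds — finite pattern type), `f S := Ū^S` (n08-w3's hybrid maps: EML on `S`, axial off `S`); across levels
`pat` = the firing pattern `Γ(U)` of the trajectory and `f Γ = Φ_Γ` the fixed hybrid composite.
HONEST: count-neutral helper; hTop ∕ (a)′∀ ∕ hJ NOT proved; N08 NOT discharged; R3 ≠ d = 4 ∕ mass gap ∕ Clay.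
-/

noncomputable section

open MeasureTheory
open scoped ENNReal

namespace Summit.QuantumFields.YangMills.Theorems.BalabanUVNodesN08PatternPartition

variable {α β Pat : Type*} [MeasurableSpace α] [MeasurableSpace β] [Fintype Pat] [MeasurableSpace Pat] [MeasurableSingletonClass Pat]

/-- **Finite pattern partition of a measure**: `μ A = Σ_s μ (A ∩ pat⁻¹{s})` for a measurable pattern map into a finite type. [folklore] -/
theorem measure_eq_sum_measure_inter_preimage_singleton (μ : Measure α) {pat : α → Pat} (hpat : Measurable pat) {A : Set α} (hA : MeasurableSet A) :
    μ A = ∑ s, μ (A ∩ pat ⁻¹' {s}) := by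
  classical
  have hcover : A = ⋃ s, (A ∩ pat ⁻¹' {s}) := by
    ext x; simp
  have hdisj : Pairwise (Function.onFun Disjoint fun s => A ∩ pat ⁻¹' {s}) := by
    intro s t hst
    refine Set.disjoint_left.mpr fun x hx hx' => hst ?_
    exact hx.2.symm.trans hx'.2
  conv_lhs => rw [hcover]
  rw [measure_iUnion hdisj fun s => hA.inter (hpat (measurableSet_singleton s)), tsum_fintype]

/-- ★★ **THE EXACT PATTERN PARTITION OF A PUSH-FORWARD**: if `F x = f (pat x) x` for every `x` (a guarded map agreeing with the FIXED map `f s` on the pattern class `{pat = s}`),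
then `μ.map F = Σ_s (μ.restrict (pat ⁻¹' {s})).map (f s)` — exactly, no inclusion–exclusion, no overcounting. [folklore] -/
theorem map_eq_sum_map_restrict_of_pattern (μ : Measure α) {pat : α → Pat} (hpat : Measurable pat)
    {F : α → β} (hF : Measurable F) {f : Pat → α → β} (hf : ∀ s, Measurable (f s)) (hFf : ∀ x, F x = f (pat x) x) :
    μ.map F = ∑ s, (μ.restrict (pat ⁻¹' {s})).map (f s) := by
  classical
  ext B hB
  rw [Measure.map_apply hF hB, Measure.coe_finsetSum, Finset.sum_apply,
    measure_eq_sum_measure_inter_preimage_singleton μ hpat (hF hB)]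
  refine Finset.sum_congr rfl fun s _ => ?_
  rw [Measure.map_apply (hf s) hB, Measure.restrict_apply ((hf s) hB)]
  congr 1
  ext x
  simp only [Set.mem_inter_iff, Set.mem_preimage, Set.mem_singleton_iff]
  constructor
  · rintro ⟨hx, hs⟩; exact ⟨by rw [← hs, ← hFf x]; exact hx, hs⟩
  · rintro ⟨hx, hs⟩; exact ⟨by rw [hFf x, hs]; exact hx, hs⟩

/-- **Monotone truncation to a set of patterns**: if `pat x ∈ A` for `μ`-a.e. `x`, then `μ.map F ≤ Σ_{s ∈ A} (μ.restrict (pat ⁻¹' {s})).map (f s)` (with equality; stated as `≤`, the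
form a density bound consumes). [folklore] -/
theorem map_le_sum_map_restrict_of_pattern_subset (μ : Measure α) {pat : α → Pat} (hpat : Measurable pat)
    {F : α → β} (hF : Measurable F) {f : Pat → α → β} (hf : ∀ s, Measurable (f s)) (hFf : ∀ x, F x = f (pat x) x)
    (A : Finset Pat) (hA : ∀ᵐ x ∂μ, pat x ∈ A) :
    μ.map F ≤ ∑ s ∈ A, (μ.restrict (pat ⁻¹' {s})).map (f s) := by
  classical
  rw [map_eq_sum_map_restrict_of_pattern μ hpat hF hf hFf]
  have hzero : ∀ s, s ∉ A → (μ.restrict (pat ⁻¹' {s})).map (f s) = 0 := by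
    intro s hs
    have h0 : μ (pat ⁻¹' {s}) = 0 := by
      have hnull : μ {x | ¬ pat x ∈ A} = 0 := ae_iff.mp hA
      refine measure_mono_null (fun x hx => ?_) hnull
      rw [Set.mem_preimage, Set.mem_singleton_iff] at hx
      show ¬ pat x ∈ A
      rw [hx]; exact hs
    rw [Measure.restrict_eq_zero.mpr h0, Measure.map_zero]
  rw [← Finset.sum_subset (Finset.subset_univ A) (fun s _ hs => hzero s hs)]

end Summit.QuantumFields.YangMills.Theorems.BalabanUVNodesN08PatternPartition

end
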